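import Mathlib.LinearAlgebra.Dual.Lemmas
import Literature.Computability.MetaComplexity.ResLinWinningStrategy
import Literature.Computability.MetaComplexity.ResLinWidth
import Literature.Computability.MetaComplexity.ResLinResolventImplication
import Literature.Computability.MetaComplexity.LinearMapResolutionWidthProofs
import HarnessLib

/-!
# Gaussian elimination inside Res(⊕): XOR-CNFs of unsolvable `𝔽₂`-systems have NARROW refutations

The folklore upper bound complementing the width-lifting theorem (`ResLinWidthLifting.lean`):
Res(⊕) refutes the canonical CNF encoding `sumEncoding 1 E` (Beck's sum-encoding with one
Boolean variable per unknown = Krajíček's `¬τ_b(A)`, the XOR-CNF / Tseitin-type formula of the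
system) of every UNSOLVABLE system `E` of `𝔽₂`-equations with row supports of size `≤ ℓ` by a
refutation all of whose lines have at most `max ℓ 2` linear literals — hence rank-width
`≤ max ℓ 2` — by Gaussian elimination [Itsykson–Sokolov 2020, §3 (upper bounds for linear
systems); Krajíček 2019, §7.1]:

1. every row equation `Σ_{j ∈ supp} x_j = b` is derived as ONE linear literal from the `2^{ℓ-1}`
   clauses of its canonical CNF within literal-width `ℓ` (`resLinDerivableWithin_row`: weaken the
   canonical clause violated by a pattern to "row equation ∨ (the other variables differ from the
   pattern)", then resolve out the other variables along the complete binary tree,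
   `ResLinDerivableWithin.tree`);
2. two equations are summed in literal-width `2` (`ResLinDerivableWithin.sum`: weaken `f = a` to
   `(f ∆ g = a ⊕ b) ∨ (g = ¬b)` and resolve with `g = b`);
3. an unsolvable system has an `𝔽₂`-combination of rows equal to `0 = 1` (`exists_zmod2_certificate`,
   the Fredholm alternative), whose Res(⊕)-sum is the identically false literal `0 = 1`, weakened
   to `∅`.

Main statements: `exists_isResLinRefutation_sumEncoding_narrow`,
`minResLinWidth_sumEncoding_le : ¬ SystemSat E univ → minResLinWidth (sumEncoding 1 E) ≤ max ℓ 2`.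
Contrast (the point of gadget lifting): by Krajíček 2019 Lemma 13.4.5
(`Krajicek2019_lemma_13_4_5_holds`) the same CNFs need RESOLUTION width `≥ r/4` when the rows form
an `(r, 3ℓ/4)`-boundary expander, and their 1-stifling LIFTS need Res(⊕) rank `≥ r/4`
(`Summits/PneNP/PneNP/Theorems/ReslinSizeFromWidthLifting.lean`).

## References

* D. Itsykson, D. Sokolov, *Resolution over linear equations modulo two*, Ann. Pure Appl. Logic
  171 (2020), §3 (upper bounds for linear systems) [ItsyksonSokolov2020].
* J. Krajíček, *Proof Complexity* (CUP 2019), §7.1 (R(LIN)), Lemma 13.4.5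
  [KrajicekProofComplexity2019].
-/

namespace Literature.Computability.MetaComplexity

open _root_.Computability Complexity Finset

/-! ### Two derived rules of Res(⊕) within bounded literal-width -/

/-- The linear clause of `l :: c` is `l` added to the linear clause of `c`. [Itsykson–Sokolov 2020,
§2] [cite: ItsyksonSokolov2020, §2] -/
theorem toLinClause_cons (l : Literal ℕ) (c : Clause ℕ) :
    Clause.toLinClause (l :: c) = insert l.toLinLit (Clause.toLinClause c) := by
  unfold Clause.toLinClause
  rw [List.map_cons, List.toFinset_cons]

/-- The linear clause of the empty clause is empty. [Itsykson–Sokolov 2020, §2]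
[cite: ItsyksonSokolov2020, §2] -/
@[simp] theorem toLinClause_nil : Clause.toLinClause ([] : Clause ℕ) = ∅ := rfl

/-- A literal of a clause gives a linear literal of its linear clause. [Itsykson–Sokolov 2020, §2]
[cite: ItsyksonSokolov2020, §2] -/
theorem toLinLit_mem_toLinClause {l : Literal ℕ} {c : Clause ℕ} (h : l ∈ c) :
    l.toLinLit ∈ Clause.toLinClause c := by
  unfold Clause.toLinClause
  rw [List.mem_toFinset, List.mem_map]
  exact ⟨l, h, rfl⟩

/-- A unit linear clause is true iff its literal is. [Itsykson–Sokolov 2020, §2]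
[cite: ItsyksonSokolov2020, §2] -/
theorem linClause_eval_singleton (σ : ℕ → Bool) (l : LinLit) :
    LinClause.eval σ {l} = LinLit.eval σ l := by
  unfold LinClause.eval
  by_cases h : LinLit.eval σ l = true <;> simp [h]

/-- **The sum rule** (Gaussian step) within literal-width `2`: from the unit clauses `f = a` and
`g = b` derive `f ∆ g = a ⊕ b` (weaken `f = a` to `(f ∆ g = a ⊕ b) ∨ (g = ¬b)`, resolve with
`g = b` on `g`). [Itsykson–Sokolov 2020, §3 (Res(⊕) simulates Gaussian elimination)]
[cite: ItsyksonSokolov2020, §3] -/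
theorem ResLinDerivableWithin.sum {φ : CNF ℕ} {k : ℕ} (hk : 2 ≤ k) {f g : Finset ℕ} {a b : Bool}
    (hf : ResLinDerivableWithin φ k {(f, a)}) (hg : ResLinDerivableWithin φ k {(g, b)}) :
    ResLinDerivableWithin φ k {(symmDiff f g, xor a b)} := by
  classical
  have hW : ResLinDerivableWithin φ k (insert (g, !b) {(symmDiff f g, xor a b)}) := by
    refine .weaken _ _ hf (fun σ hσ => ?_) ((Finset.card_insert_le _ _).trans (by simpa using hk))
    rw [linClause_eval_singleton] at hσ
    by_cases hgb : LinLit.eval σ (g, b) = true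
    · exact linClause_eval_eq_true_of_mem (Finset.mem_insert_of_mem (Finset.mem_singleton_self _))
        (linLit_eval_symmDiff σ f g a b hσ hgb)
    · apply linClause_eval_eq_true_of_mem (Finset.mem_insert_self _ _)
      rw [linLit_eval_not]
      simpa using hgb
  cases b with
  | false =>
    have h := ResLinDerivableWithin.resolve (φ := φ) (k := k) ∅ {(symmDiff f g, xor a false)} g
      (by simpa using hg) (by simpa using hW) (by simp; omega)
    simpa using h
  | true =>
    have h := ResLinDerivableWithin.resolve (φ := φ) (k := k) {(symmDiff f g, xor a true)} ∅ g
      (by simpa using hW) (by simpa using hg) (by simp; omega)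
    simpa using h

/-- Summing a nonempty LIST of unit clauses: `(∆ᵢ fᵢ = ⊕ᵢ bᵢ)` is derivable within literal-width
`k ≥ 2` if every `(fᵢ = bᵢ)` is. [Itsykson–Sokolov 2020, §3] [cite: ItsyksonSokolov2020, §3] -/
theorem ResLinDerivableWithin.listSum {φ : CNF ℕ} {k : ℕ} (hk : 2 ≤ k) {ι : Type*}
    (fm : ι → Finset ℕ) (bt : ι → Bool) :
    ∀ L : List ι, L ≠ [] → (∀ i ∈ L, ResLinDerivableWithin φ k {(fm i, bt i)}) →
      ResLinDerivableWithin φ k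
        {((L.map fm).foldr symmDiff ∅, (L.map bt).foldr xor false)} := by
  intro L
  induction L with
  | nil => intro h; exact absurd rfl h
  | cons i L ih =>
    intro _ h
    by_cases hL : L = []
    · subst hL
      have e : symmDiff (fm i) (∅ : Finset ℕ) = fm i := by ext; simp [Finset.mem_symmDiff]
      simpa [e] using h i (by simp)
    · have h1 := ih hL fun i' hi' => h i' (List.mem_cons_of_mem _ hi')
      have h2 := ResLinDerivableWithin.sum hk (h i List.mem_cons_self) h1
      simpa [List.map_cons, List.foldr_cons] using h2

/-- **Tree resolution with a side clause.** If for every pattern `S ⊆ V` (`V` duplicate-free) the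
clause `E ∨ ⋁_{v ∈ V} (x_v ≠ [v ∈ S])` is derivable within literal-width `k ≥ |E| + |V|`, then `E` is
derivable within `k` (resolve out the variables of `V` along the complete binary tree).
[Itsykson–Sokolov 2020, §3; folklore] [cite: ItsyksonSokolov2020, §3] -/
theorem ResLinDerivableWithin.tree {φ : CNF ℕ} {k : ℕ} :
    ∀ (V : List ℕ) (E : LinClause), V.Nodup → E.card + V.length ≤ k →
      (∀ S ∈ V.sublists, ResLinDerivableWithin φ k
        (E ∪ Clause.toLinClause (V.map fun v => (v, decide (v ∉ S))))) →
      ResLinDerivableWithin φ k E := by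
  classical
  intro V
  induction V with
  | nil =>
    intro E _ _ h
    simpa using h [] (by simp)
  | cons v V ih =>
    intro E hnd hk h
    rw [List.nodup_cons] at hnd
    obtain ⟨hvV, hndV⟩ := hnd
    rw [List.length_cons] at hk
    -- patterns without `v`: the literal of `v` is `x_v = 1`
    have hmap0 : ∀ S ∈ V.sublists,
        Clause.toLinClause ((v :: V).map fun w => (w, decide (w ∉ S))) =
          insert (({v} : Finset ℕ), true) (Clause.toLinClause (V.map fun w => (w, decide (w ∉ S)))) := by
      intro S hS
      have hvS : v ∉ S := fun hv => hvV ((List.mem_sublists.1 hS).subset hv)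
      rw [List.map_cons, toLinClause_cons]
      simp [Literal.toLinLit, hvS]
    -- patterns with `v`: the literal of `v` is `x_v = 0`, the others are unchanged
    have hmap1 : ∀ S ∈ V.sublists,
        Clause.toLinClause ((v :: V).map fun w => (w, decide (w ∉ v :: S))) =
          insert (({v} : Finset ℕ), false) (Clause.toLinClause (V.map fun w => (w, decide (w ∉ S)))) := by
      intro S _
      rw [List.map_cons, toLinClause_cons]
      have htail : (V.map fun w => (w, decide (w ∉ v :: S))) = V.map fun w => (w, decide (w ∉ S)) := by
        refine List.map_congr_left fun w hw => ?_
        have hwv : w ≠ v := fun h' => hvV (h' ▸ hw)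
        simp [hwv]
      rw [htail]
      simp [Literal.toLinLit]
    have hbound : ∀ c : Bool, (insert (({v} : Finset ℕ), c) E).card + V.length ≤ k := fun c => by
      have := Finset.card_insert_le (({v} : Finset ℕ), c) E
      omega
    have h1 : ResLinDerivableWithin φ k (insert (({v} : Finset ℕ), true) E) := by
      refine ih _ hndV (hbound true) fun S hS => ?_
      have hmem : S ∈ (v :: V).sublists := List.mem_sublists.2 ((List.mem_sublists.1 hS).cons v)
      have := h S hmem
      rw [hmap0 S hS, Finset.union_insert] at this
      rwa [Finset.insert_union]
    have h0 : ResLinDerivableWithin φ k (insert (({v} : Finset ℕ), false) E) := by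
      refine ih _ hndV (hbound false) fun S hS => ?_
      have hmem : (v :: S) ∈ (v :: V).sublists :=
        List.mem_sublists.2 ((List.mem_sublists.1 hS).cons_cons v)
      have := h (v :: S) hmem
      rw [hmap1 S hS, Finset.union_insert] at this
      rwa [Finset.insert_union]
    have hE : (E ∪ E).card ≤ k := by rw [Finset.union_idempotent]; omega
    have := ResLinDerivableWithin.resolve E E {v} h0 h1 hE
    rwa [Finset.union_idempotent] at this

/-! ### The rows of a `B = 1` sum-encoding as linear literals -/

section Rows

variable {n m : ℕ}

/-- The block of the unknown `j` in the `B = 1` encoding is the single variable `j`. [Beck 2017,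
Def. 5.6] [folklore] -/
private theorem encBlock_one_eq_singleton (j : ℕ) : encBlock 1 j = [j] := by
  rw [show (1 : ℕ) = 0 + 1 from rfl]
  simp [xorBlock, List.range_succ]

/-- The variables of a row of the `B = 1` encoding are (the casts of) its support.
[Beck 2017, Def. 5.6] [folklore] -/
private theorem mem_eqVars_one_iff_mem_map {E : LinEqMod 2 n} {v : ℕ} :
    v ∈ eqVars 1 E ↔ v ∈ E.supp.map Fin.valEmbedding := by
  rw [mem_eqVars, Finset.mem_map]
  simp only [encBlock_one_eq_singleton, List.mem_singleton, Fin.valEmbedding_apply]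
  constructor
  · rintro ⟨i, hi, rfl⟩; exact ⟨i, hi, rfl⟩
  · rintro ⟨i, hi, rfl⟩; exact ⟨i, hi, rfl⟩

/-- In `𝔽₂` a coefficient in the support is `1`. [folklore] -/
private theorem coeff_eq_one_of_mem_supp_two {E : LinEqMod 2 n} {j : Fin n} (hj : j ∈ E.supp) : E.1 j = 1 := by
  have hne : E.1 j ≠ 0 := (Finset.mem_filter.1 hj).2
  have : ∀ x : ZMod 2, x ≠ 0 → x = 1 := by decide
  exact this _ hne

/-- **Semantics of a row**: the canonical CNF of the row `E` (with `B = 1`) is true at `σ` iff the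
linear literal `(supp E = [b = 1])` is, i.e. iff `Σ_{j ∈ supp E} σ_j = b` in `𝔽₂`.
[Beck 2017, Def. 5.6; Itsykson–Sokolov 2020, §2] [cite: ItsyksonSokolov2020, §2] -/
theorem eval_equationCNF_one (E : LinEqMod 2 n) (σ : ℕ → Bool) :
    (equationCNF 1 E).eval σ = LinLit.eval σ (E.supp.map Fin.valEmbedding, decide (E.2 = 1)) := by
  rw [eval_equationCNF, Bool.eq_iff_iff, linLit_eval_eq_true_iff_sum]
  simp only [decide_eq_true_eq, LinEqMod.Holds]
  rw [Finset.sum_map]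
  have hsum : ∑ j, E.1 j * blockVals 2 1 n σ j =
      ∑ j ∈ E.supp, (if σ (Fin.valEmbedding j) = true then (1 : ZMod 2) else 0) := by
    rw [← Finset.sum_subset (Finset.subset_univ E.supp) (fun j _ hj => by
      have : E.1 j = 0 := by simpa [LinEqMod.supp] using hj
      rw [this, zero_mul])]
    refine Finset.sum_congr rfl fun j hj => ?_
    rw [coeff_eq_one_of_mem_supp_two hj, one_mul, blockVals_two_one_apply, Fin.valEmbedding_apply]
  rw [hsum]
  have key : ∀ x s : ZMod 2, (s = x ↔ s = if x = 1 then 1 else 0) := by decide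
  exact key E.2 _

/-- Flipping one variable of the support flips the row literal. [folklore] -/
theorem linLit_eval_flip {f : Finset ℕ} {u : ℕ} (hu : u ∈ f) {σ σ₀ : ℕ → Bool}
    (hagree : ∀ w ∈ f, w ≠ u → σ w = σ₀ w) (hdiff : σ u ≠ σ₀ u) (b : Bool) :
    LinLit.eval σ (f, b) = !LinLit.eval σ₀ (f, b) := by
  have hsum : ∑ v ∈ f, (if σ v = true then (1 : ZMod 2) else 0) =
      ∑ v ∈ f, (if σ₀ v = true then (1 : ZMod 2) else 0) + 1 := by
    rw [← Finset.add_sum_erase f _ hu, ← Finset.add_sum_erase f _ hu]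
    have h1 : ∑ v ∈ f.erase u, (if σ v = true then (1 : ZMod 2) else 0) =
        ∑ v ∈ f.erase u, (if σ₀ v = true then (1 : ZMod 2) else 0) :=
      Finset.sum_congr rfl fun w hw => by
        rw [hagree w (Finset.mem_of_mem_erase hw) (Finset.ne_of_mem_erase hw)]
    have h2 : (if σ u = true then (1 : ZMod 2) else 0) = (if σ₀ u = true then (1 : ZMod 2) else 0) + 1 := by
      have : ∀ s t : Bool, s ≠ t →
          (if s = true then (1 : ZMod 2) else 0) = (if t = true then 1 else 0) + 1 := by decide
      exact this _ _ hdiff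
    rw [h1, h2]
    ring
  have e1 := linLit_eval_eq_true_iff_sum σ f b
  have e0 := linLit_eval_eq_true_iff_sum σ₀ f b
  rw [hsum] at e1
  have key : ∀ (s t : ZMod 2) (p q : Bool), (p = true ↔ s + 1 = t) → (q = true ↔ s = t) → p = !q := by
    decide
  exact key _ _ _ _ e1 e0

/-- **A row equation is derivable as one linear literal** within literal-width `k ≥ max |supp| 1`:
from the canonical clauses of the row (one per violating pattern) Res(⊕) derives
`(supp E = b)` — unless the row is the trivial `0 = 0` (then nothing needs deriving). (Weaken the
clause violated by a suitable pattern to "row equation ∨ the other variables differ from the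
pattern", then `ResLinDerivableWithin.tree`.) [Itsykson–Sokolov 2020, §3]
[cite: ItsyksonSokolov2020, §3] -/
theorem resLinDerivableWithin_row (E : Fin m → LinEqMod 2 n) {k : ℕ} (i : Fin m)
    (hk : (E i).supp.card ≤ k) (hk1 : 1 ≤ k) :
    ((E i).supp = ∅ ∧ (E i).2 = 0) ∨
      ResLinDerivableWithin (sumEncoding 1 E) k
        {((E i).supp.map Fin.valEmbedding, decide ((E i).2 = 1))} := by
  classical
  -- clauses of the row are initial clauses of the encoding
  have hinit : ∀ C ∈ equationCNF 1 (E i), C ∈ sumEncoding 1 E := fun C hC =>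
    List.mem_flatMap.2 ⟨i, List.mem_finRange i, hC⟩
  set f : Finset ℕ := (E i).supp.map Fin.valEmbedding with hf
  set b : Bool := decide ((E i).2 = 1) with hbdef
  set V : List ℕ := eqVars 1 (E i) with hV
  have hVnd : V.Nodup := nodup_eqVars 1 (E i)
  have hVf : ∀ v, v ∈ V ↔ v ∈ f := fun v => mem_eqVars_one_iff_mem_map
  have hVlen : V.length = (E i).supp.card := by rw [hV, length_eqVars, mul_one]
  have hfcard : f.card = (E i).supp.card := Finset.card_map _
  -- every clause of the row has the canonical shape
  have hshape : ∀ C ∈ equationCNF 1 (E i), ∃ S ∈ V.sublists,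
      C = V.map fun v => (v, decide (v ∉ S)) := by
    intro C hC
    unfold equationCNF canonicalCNF at hC
    obtain ⟨S, hS, rfl⟩ := List.mem_map.1 hC
    exact ⟨S, (List.mem_filter.1 hS).1, rfl⟩
  -- a violating assignment has a falsified canonical clause
  have hviol : ∀ σ₀ : ℕ → Bool, LinLit.eval σ₀ (f, b) = false →
      ∃ S ∈ V.sublists, (V.map fun v => (v, decide (v ∉ S))) ∈ equationCNF 1 (E i) ∧
        ∀ v ∈ V, σ₀ v = decide (v ∈ S) := by
    intro σ₀ hσ₀
    have hev : (equationCNF 1 (E i)).eval σ₀ = false := by rw [eval_equationCNF_one]; exact hσ₀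
    have hex : ∃ C ∈ equationCNF 1 (E i), Clause.eval σ₀ C = false := by
      by_contra hne
      push Not at hne
      have : (equationCNF 1 (E i)).eval σ₀ = true :=
        (CNF.eval_eq_true_iff _ _).2 fun C hC => by
          have := hne C hC; revert this; cases Clause.eval σ₀ C <;> simp
      rw [hev] at this
      exact Bool.false_ne_true this
    obtain ⟨C, hC, hCf⟩ := hex
    obtain ⟨S, hS, rfl⟩ := hshape C hC
    exact ⟨S, hS, hC, (any_canonicalClause_eq_false_iff σ₀).1 hCf⟩
  rcases hVcases : V with _ | ⟨u, V'⟩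
  · -- empty support: the row is `0 = b`
    have hsupp : (E i).supp = ∅ := by
      rw [← Finset.card_eq_zero, ← hVlen, hVcases]; rfl
    have hf0 : f = ∅ := by rw [hf, hsupp, Finset.map_empty]
    have hx : ∀ x : ZMod 2, x = 0 ∨ x = 1 := by decide
    rcases hx (E i).2 with h0 | h1
    · exact Or.inl ⟨hsupp, h0⟩
    · right
      -- the row `0 = 1`: its canonical CNF contains the empty clause
      have hb : b = true := by rw [hbdef, h1]; rfl
      obtain ⟨S, -, hmem, -⟩ := hviol (fun _ => false) (by
        rw [hf0, hb]; simp [LinLit.eval])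
      rw [hVcases] at hmem
      simp only [List.map_nil] at hmem
      have hE0 : ResLinDerivableWithin (sumEncoding 1 E) k ∅ := by
        simpa using ResLinDerivableWithin.initial [] (hinit [] hmem) (by simp)
      exact .weaken _ _ hE0 (fun σ hσ => by simp at hσ) (by simpa using hk1)
  · right
    -- `V = u :: V'`: derive `(f = b)` by the tree over `V'` with side clause `{(f = b)}`
    have hnd' : u ∉ V' ∧ V'.Nodup := by
      have := hVnd; rw [hVcases, List.nodup_cons] at this; exact this
    have huf : u ∈ f := (hVf u).1 (by rw [hVcases]; exact List.mem_cons_self)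
    have hV'f : ∀ w ∈ V', w ∈ f := fun w hw => (hVf w).1 (by rw [hVcases]; exact List.mem_cons_of_mem _ hw)
    have hfV : ∀ w ∈ f, w ≠ u → w ∈ V' := by
      intro w hw hwu
      have := (hVf w).2 hw
      rw [hVcases, List.mem_cons] at this
      exact this.resolve_left hwu
    refine ResLinDerivableWithin.tree V' {(f, b)} hnd'.2 (by
      rw [Finset.card_singleton]; rw [hVcases, List.length_cons] at hVlen; omega) fun S' hS' => ?_
    -- a violating pattern extending `S'`
    let σc : Bool → ℕ → Bool := fun c v => if v = u then c else decide (v ∈ S')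
    have hflip : LinLit.eval (σc true) (f, b) = !LinLit.eval (σc false) (f, b) :=
      linLit_eval_flip huf (fun w _ hwu => by simp [σc, hwu]) (by simp [σc]) b
    obtain ⟨c, hc⟩ : ∃ c, LinLit.eval (σc c) (f, b) = false := by
      cases h : LinLit.eval (σc false) (f, b)
      · exact ⟨false, h⟩
      · exact ⟨true, by rw [hflip, h]; rfl⟩
    obtain ⟨S, -, hmem, hpat⟩ := hviol (σc c) hc
    -- the canonical clause of `S`, an initial clause, weakens to the target
    have hC : ResLinDerivableWithin (sumEncoding 1 E) k
        (Clause.toLinClause (V.map fun v => (v, decide (v ∉ S)))) :=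
      .initial _ (hinit _ hmem) ((card_toLinClause_le _).trans (by rw [List.length_map, hVlen]; exact hk))
    refine .weaken _ _ hC (fun σ hσ => ?_) ?_
    · -- validity of the weakening
      rw [eval_toLinClause, List.any_eq_true] at hσ
      obtain ⟨l, hl, hlev⟩ := hσ
      obtain ⟨v, hv, rfl⟩ := List.mem_map.1 hl
      -- `σ` differs from the pattern at `v`
      have hdiffv : σ v ≠ σc c v := by
        rw [hpat v hv]
        simp only [Literal.eval, beq_iff_eq] at hlev
        rw [hlev]
        by_cases hvS : v ∈ S <;> simp [hvS]
      by_cases hcase : ∃ w ∈ V', σ w ≠ σc c w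
      · -- a side literal is true
        obtain ⟨w, hw, hσw⟩ := hcase
        have hwu : w ≠ u := fun h' => hnd'.1 (h' ▸ hw)
        have hσw' : σ w = decide (w ∉ S') := by
          have : σc c w = decide (w ∈ S') := by simp [σc, hwu]
          rw [this] at hσw
          revert hσw; cases σ w <;> by_cases hwS : w ∈ S' <;> simp [hwS]
        apply linClause_eval_eq_true_of_mem (Finset.mem_union_right _
          (toLinLit_mem_toLinClause (List.mem_map.2 ⟨w, hw, rfl⟩)))
        simp [Literal.toLinLit, LinLit.eval, Finset.filter_singleton, hσw']
        by_cases hwS : w ∈ S' <;> simp [hwS]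
      · -- `σ` agrees with the pattern on `V'`, hence differs from it at `u`: the row literal flips
        push Not at hcase
        have hvu : v = u := by
          by_contra hvu
          have hvV' : v ∈ V' := by
            have : v ∈ V := hv
            rw [hVcases, List.mem_cons] at this
            exact this.resolve_left hvu
          exact hdiffv (hcase v hvV')
        subst hvu
        have hrow : LinLit.eval σ (f, b) = true := by
          rw [linLit_eval_flip huf (fun w hw hwu => hcase w (hfV w hw hwu)) hdiffv b, hc]
          rfl
        exact linClause_eval_eq_true_of_mem (Finset.mem_union_left _ (Finset.mem_singleton_self _)) hrow
    · -- width of the target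
      have h1 : (Clause.toLinClause (V'.map fun w => (w, decide (w ∉ S')))).card ≤ V'.length :=
        (card_toLinClause_le _).trans (by rw [List.length_map])
      have h2 := Finset.card_union_le ({(f, b)} : LinClause)
        (Clause.toLinClause (V'.map fun w => (w, decide (w ∉ S'))))
      rw [Finset.card_singleton] at h2
      rw [hVcases, List.length_cons] at hVlen
      omega

/-! ### The Fredholm alternative over `𝔽₂` -/

/-- **Certificate of unsolvability** (Fredholm alternative over `𝔽₂`): if the system `E` has no
solution, some `𝔽₂`-combination of its rows is the equation `0 = 1`. [folklore; cf. Krajíček 2019,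
§13.4 (`b ∉ rng(A)`)] [folklore] -/
theorem exists_zmod2_certificate (E : Fin m → LinEqMod 2 n) (h : ¬ SystemSat E Finset.univ) :
    ∃ c : Fin m → ZMod 2, (∀ j, ∑ i, c i * (E i).1 j = 0) ∧ ∑ i, c i * (E i).2 = 1 := by
  classical
  let A : (Fin n → ZMod 2) →ₗ[ZMod 2] (Fin m → ZMod 2) :=
    { toFun := fun z i => ∑ j, (E i).1 j * z j
      map_add' := by
        intro z z'; funext i
        simp only [Pi.add_apply, mul_add, sum_add_distrib]
      map_smul' := by
        intro r z; funext i
        simp only [Pi.smul_apply, smul_eq_mul, RingHom.id_apply]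
        rw [mul_sum]
        refine sum_congr rfl fun j _ => ?_
        ring }
  have hA : ∀ z i, A z i = ∑ j, (E i).1 j * z j := fun _ _ => rfl
  let bv : Fin m → ZMod 2 := fun i => (E i).2
  have hb : bv ∉ LinearMap.range A := by
    rintro ⟨z, hz⟩
    exact h ⟨z, fun i _ => by
      have := congrFun hz i
      rw [hA] at this
      exact this⟩
  obtain ⟨φ, hφb, hφ⟩ := Submodule.exists_dual_map_eq_bot_of_notMem hb inferInstance
  let c : Fin m → ZMod 2 := fun i => φ (Pi.single i 1)
  have hkey : ∀ y : Fin m → ZMod 2, φ y = ∑ i, c i * y i := by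
    intro y
    rw [LinearMap.pi_apply_eq_sum_univ φ y]
    refine sum_congr rfl fun i _ => ?_
    have : (fun j : Fin m => if i = j then (1 : ZMod 2) else 0) = Pi.single i 1 := by
      funext j; simp [Pi.single_apply, eq_comm]
    rw [this, smul_eq_mul, mul_comm]
  have hφA : ∀ z, φ (A z) = 0 := fun z =>
    (Submodule.eq_bot_iff _).1 hφ _ (Submodule.mem_map_of_mem (LinearMap.mem_range_self A z))
  refine ⟨c, fun j => ?_, ?_⟩
  · have hAj : A (Pi.single j 1) = fun i => (E i).1 j := by
      funext i
      rw [hA, sum_eq_single j]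
      · simp
      · intro j' _ hne; simp [hne]
      · simp
    have := hφA (Pi.single j 1)
    rw [hAj, hkey] at this
    exact this
  · have h1 := hkey bv
    have hne : ∑ i, c i * bv i ≠ 0 := by rw [← h1]; exact hφb
    have : ∀ x : ZMod 2, x ≠ 0 → x = 1 := by decide
    exact this _ hne

/-! ### Folded symmetric differences read coefficientwise -/

/-- Membership in an iterated symmetric difference is the parity of the number of members.
[folklore] -/
theorem mem_foldr_symmDiff_iff {ι : Type*} (F : ι → Finset ℕ) (v : ℕ) :
    ∀ L : List ι, v ∈ (L.map F).foldr symmDiff ∅ ↔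
      (L.map fun i => if v ∈ F i then (1 : ZMod 2) else 0).sum = 1 := by
  intro L
  induction L with
  | nil => simp
  | cons i L ih =>
    rw [List.map_cons, List.foldr_cons, Finset.mem_symmDiff, ih, List.map_cons, List.sum_cons]
    set x : ZMod 2 := (if v ∈ F i then (1 : ZMod 2) else 0) with hxdef
    have hx : x = 0 ∨ x = 1 := by by_cases h : v ∈ F i <;> simp [hxdef, h]
    have hp : (v ∈ F i) ↔ x = 1 := by by_cases h : v ∈ F i <;> simp [hxdef, h]
    rw [hp]
    have key : ∀ x s : ZMod 2, (x = 0 ∨ x = 1) →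
        ((x = 1 ∧ ¬ s = 1 ∨ s = 1 ∧ ¬ x = 1) ↔ x + s = 1) := by decide
    exact key x _ hx

/-- The iterated `xor` of bits is the parity of their sum. [folklore] -/
theorem foldr_xor_eq {ι : Type*} (bt : ι → Bool) :
    ∀ L : List ι, (L.map bt).foldr xor false =
      decide ((L.map fun i => if bt i = true then (1 : ZMod 2) else 0).sum = 1) := by
  intro L
  induction L with
  | nil => simp
  | cons i L ih =>
    rw [List.map_cons, List.foldr_cons, ih, List.map_cons, List.sum_cons]
    generalize (L.map fun i => if bt i = true then (1 : ZMod 2) else 0).sum = s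
    have hs : s = 0 ∨ s = 1 := by revert s; decide
    rcases hs with rfl | rfl <;> cases bt i <;> decide

end Rows

/-! ### The narrow refutation -/

/-- **Gaussian elimination in Res(⊕)**: the canonical XOR-CNF `sumEncoding 1 E` of an unsolvable
`𝔽₂`-system whose rows have supports of size `≤ ℓ` has a Res(⊕) refutation (resolution rule +
semantic weakening) all of whose lines have at most `max ℓ 2` linear literals, hence rank-width
`resLinWidth ≤ max ℓ 2`. [Itsykson–Sokolov 2020, §3] [cite: ItsyksonSokolov2020, §3] -/
theorem exists_isResLinRefutation_sumEncoding_narrow {n m ℓ : ℕ} (E : Fin m → LinEqMod 2 n)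
    (hsparse : ∀ i, (E i).supp.card ≤ ℓ) (hunsat : ¬ SystemSat E Finset.univ) :
    ∃ π : List ResLinLine, IsResLinRefutation (sumEncoding 1 E) π ∧
      (∀ l ∈ π, l.clause.card ≤ max ℓ 2) ∧ resLinWidth π ≤ max ℓ 2 := by
  classical
  set k : ℕ := max ℓ 2 with hkdef
  have hk2 : 2 ≤ k := le_max_right _ _
  obtain ⟨c, hcA, hcb⟩ := exists_zmod2_certificate E hunsat
  -- the nontrivial rows of the certificate
  let good : Fin m → Prop := fun i => c i = 1 ∧ ¬ ((E i).supp = ∅ ∧ (E i).2 = 0)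
  set L : List (Fin m) := (Finset.univ.filter good).toList with hL
  have hLmem : ∀ i, i ∈ L ↔ good i := fun i => by rw [hL, Finset.mem_toList, Finset.mem_filter]; simp
  let fm : Fin m → Finset ℕ := fun i => (E i).supp.map Fin.valEmbedding
  let bt : Fin m → Bool := fun i => decide ((E i).2 = 1)
  -- every nontrivial row is derivable as a unit clause
  have hrows : ∀ i ∈ L, ResLinDerivableWithin (sumEncoding 1 E) k {(fm i, bt i)} := by
    intro i hi
    rcases resLinDerivableWithin_row E i ((hsparse i).trans (le_max_left _ _))
      (le_trans (by norm_num) hk2) with h | h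
    · exact absurd h ((hLmem i).1 hi).2
    · exact h
  -- sums over `L` are the certificate sums
  have h01 : ∀ x : ZMod 2, x = 0 ∨ x = 1 := by decide
  have hc01 : ∀ i, c i = 0 ∨ c i = 1 := fun i => h01 (c i)
  have hsumL : ∀ g : Fin m → ZMod 2, (∀ i, (E i).supp = ∅ ∧ (E i).2 = 0 → g i = 0) →
      (L.map g).sum = ∑ i, c i * g i := by
    intro g hg
    rw [hL, Finset.sum_map_toList, Finset.sum_filter]
    refine Finset.sum_congr rfl fun i _ => ?_
    by_cases h : good i
    · rw [if_pos h, h.1, one_mul]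
    · rw [if_neg h]
      rcases hc01 i with h0 | h1
      · rw [h0, zero_mul]
      · have htriv : (E i).supp = ∅ ∧ (E i).2 = 0 := by
          by_contra hne; exact h ⟨h1, hne⟩
        rw [hg i htriv, mul_zero]
  -- the folded form is `0`, the folded bit is `1`
  have hform : (L.map fm).foldr symmDiff ∅ = ∅ := by
    ext v
    simp only [Finset.notMem_empty, iff_false]
    rw [mem_foldr_symmDiff_iff]
    by_cases hv : ∃ j : Fin n, (j : ℕ) = v
    · obtain ⟨j, rfl⟩ := hv
      have hind : ∀ i, (if (j : ℕ) ∈ fm i then (1 : ZMod 2) else 0) = (E i).1 j := by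
        intro i
        by_cases hj : j ∈ (E i).supp
        · have : (j : ℕ) ∈ fm i := Finset.mem_map.2 ⟨j, hj, rfl⟩
          rw [if_pos this, coeff_eq_one_of_mem_supp_two hj]
        · have : (j : ℕ) ∉ fm i := by
            intro hmem
            obtain ⟨j', hj', heq⟩ := Finset.mem_map.1 hmem
            exact hj ((Fin.val_injective heq) ▸ hj')
          rw [if_neg this, eq_comm]
          simpa [LinEqMod.supp] using hj
      simp only [hind]
      rw [hsumL (fun i => (E i).1 j) (fun i hi => by
        have : j ∉ (E i).supp := by rw [hi.1]; exact Finset.notMem_empty j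
        simpa [LinEqMod.supp] using this), hcA j]
      decide
    · have hzero : ∀ i, (if v ∈ fm i then (1 : ZMod 2) else 0) = 0 := by
        intro i
        rw [if_neg]
        intro hmem
        obtain ⟨j, -, heq⟩ := Finset.mem_map.1 hmem
        exact hv ⟨j, heq⟩
      simp only [hzero, List.map_const', List.sum_replicate, smul_zero]
      decide
  have hbit : (L.map bt).foldr xor false = true := by
    rw [foldr_xor_eq]
    have hval : ∀ i, (if bt i = true then (1 : ZMod 2) else 0) = (E i).2 := by
      intro i
      have : ∀ x : ZMod 2, (if decide (x = 1) = true then (1 : ZMod 2) else 0) = x := by decide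
      exact this _
    simp only [hval]
    rw [hsumL (fun i => (E i).2) (fun i hi => hi.2), hcb]
    decide
  -- `L` is nonempty (else the certificate would sum to `0`)
  have hLne : L ≠ [] := by
    intro hnil
    have := hsumL (fun i => (E i).2) (fun i hi => hi.2)
    rw [hnil, hcb] at this
    simp at this
  -- the sum of the rows of `L` is `0 = 1`, which weakens to the empty clause
  have hsum := ResLinDerivableWithin.listSum hk2 fm bt L hLne hrows
  rw [hform, hbit] at hsum
  have hE0 : ResLinDerivableWithin (sumEncoding 1 E) k ∅ :=
    .weaken _ _ hsum (fun σ hσ => by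
      rw [linClause_eval_singleton] at hσ
      simp [LinLit.eval] at hσ) (by simp)
  obtain ⟨π, hπ, hcard⟩ := hE0.exists_isResLinRefutation
  refine ⟨π, hπ, hcard, ?_⟩
  rw [resLinWidth_le_iff]
  exact fun l hl => (linClauseRank_le_card _).trans (hcard l hl)

/-- Hence `minResLinWidth (sumEncoding 1 E) ≤ max ℓ 2` for every unsolvable `𝔽₂`-system with
`ℓ`-sparse rows — to be contrasted with the rank `≥ r/4` of its 1-stifling lifts when the rows
expand (`Summits/PneNP/PneNP/Theorems/ReslinSizeFromWidthLifting.lean`).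
[Itsykson–Sokolov 2020, §3] [cite: ItsyksonSokolov2020, §3] -/
theorem minResLinWidth_sumEncoding_le {n m ℓ : ℕ} (E : Fin m → LinEqMod 2 n)
    (hsparse : ∀ i, (E i).supp.card ≤ ℓ) (hunsat : ¬ SystemSat E Finset.univ) :
    minResLinWidth (sumEncoding 1 E) ≤ (max ℓ 2 : ℕ) := by
  obtain ⟨π, hπ, -, hw⟩ := exists_isResLinRefutation_sumEncoding_narrow E hsparse hunsat
  unfold minResLinWidth
  exact (iInf₂_le π hπ).trans (by exact_mod_cast hw)

end Literature.Computability.MetaComplexity
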